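import Literature.Dynamics.NBody.AlbouyKaloshin2012

/-!
# The printed mass relations of Albouy–Kaloshin 2012, §8

Topic `Literature/Dynamics/NBody`. Companion of `AlbouyKaloshin2012.lean` for the `pub-smale6`
cell. This file types VERBATIM the mass relations of [AlbouyKaloshin2012] §8 that are PRINTED in
closed form, with their page and equation numbers, and proves by kernel computation the part of the
Example on p. 583 that depends only on them.

Printed relations (all pages of Ann. of Math. 176 (2012)):
* (23), p. 572 (case 8.1; again 8.4, 8.5): "one of the following:
  `m₃^{-1/2} = m₄^{-1/2} + m₅^{-1/2}`, `m₄^{-1/2} = m₃^{-1/2} + m₅^{-1/2}`,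
  `m₅^{-1/2} = m₃^{-1/2} + m₄^{-1/2}`" — `Rel23`;
* (29), p. 575 (case 8.3): `m₁ m₃ = m₂ m₄` — `Rel29`;
* (32), p. 576 (case 8.6): `m₁ = m₂ and m₃ = m₄` — `Rel32` (the only printed relation that is of
  codimension 2 by itself);
* (36), p. 577 (case 8.7.1; again 8.10, 8.11): `m₁^{-1/2} ± m₂^{-1/2} ± m₅^{-1/2} = 0` — `Rel36`;
* (39), p. 577 and (40), p. 578 (cases 8.7–8.8, 8.11–8.13): `m₅² (m₃ + m₄)⁴ = m₃³ m₄³`, resp.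
  `m₅² (m₁ + m₂)⁴ = m₁³ m₂³` — one shape, `Rel39`.

NOT printed in [AlbouyKaloshin2012] and therefore NOT typed here (they are given by leading terms
only, "563 other terms" etc., pp. 574–575, 579, or not at all, 8.2.2.2 p. 575): the polynomials
`L₁ … L₈, L₅'` of 8.2.1, `K₁ … K₈` of 8.2.2.1, the even/odd parts of `P_k(y)` of 8.2.2.2 and the
degree-24 factor of 8.9.2. Consequently `avoidsPrintedRelations_example12345` below is the
kernel-checked NECESSARY-condition half of the Example on p. 583 ("as there is no relation between
the masses such as `m₃²(m₁+m₂)⁴ = m₁³m₂³` or `m₁m₃ = m₂m₄` or `m₁^{-1/2} ± m₂^{-1/2} ± m₃^{-1/2} = 0`,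
the other seven diagrams cannot be approached", p. 583 l. 16–19); it is NOT a proof of
`albouyKaloshin2012_example12345`, whose proof in the paper also evaluates the unprinted 8.2
polynomials on the permuted masses (p. 583 l. 11–15).

Encoding: bodies are `Fin 5`, masses `m : Fin 5 → ℝ`; `m^{-1/2}` is `(Real.sqrt (m i))⁻¹`; the
relations are stated for arbitrary index tuples, and "under any renumbering" is "for all pairwise
distinct indices". The square-root relations imply the polynomial relation
`(m_i⁻¹ − m_j⁻¹ − m_k⁻¹)² = 4 m_j⁻¹ m_k⁻¹` (`sqrtRel_poly`, `rel36_poly`), which is what the finite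
check uses (rational arithmetic only, as REFEREE.md C2 of the cell requires).
-/

namespace Literature.Dynamics.NBody

/-- Relation (23) of [AlbouyKaloshin2012] p. 572: `m_i^{-1/2} = m_j^{-1/2} + m_k^{-1/2}`
(there for `{i, j, k} = {3, 4, 5}` in the three possible ways). [cite: AlbouyKaloshin2012, (23) p. 572] -/
def Rel23 (m : Fin 5 → ℝ) (i j k : Fin 5) : Prop :=
  (Real.sqrt (m i))⁻¹ = (Real.sqrt (m j))⁻¹ + (Real.sqrt (m k))⁻¹

/-- Relation (29) of [AlbouyKaloshin2012] p. 575: `m₁ m₃ = m₂ m₄`, here `m_i m_k = m_j m_l`.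
[cite: AlbouyKaloshin2012, (29) p. 575] -/
def Rel29 (m : Fin 5 → ℝ) (i j k l : Fin 5) : Prop := m i * m k = m j * m l

/-- Relation (32) of [AlbouyKaloshin2012] p. 576: `m₁ = m₂ and m₃ = m₄`, here `m_i = m_j ∧ m_k = m_l`.
[cite: AlbouyKaloshin2012, (32) p. 576] -/
def Rel32 (m : Fin 5 → ℝ) (i j k l : Fin 5) : Prop := m i = m j ∧ m k = m l

/-- Relation (36) of [AlbouyKaloshin2012] p. 577: `m₁^{-1/2} ± m₂^{-1/2} ± m₅^{-1/2} = 0`, here with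
`(i, j, k)` for `(1, 2, 5)` and the two signs `s, t ∈ {1, −1}`. [cite: AlbouyKaloshin2012, (36) p. 577] -/
def Rel36 (m : Fin 5 → ℝ) (i j k : Fin 5) : Prop :=
  ∃ s t : ℝ, (s = 1 ∨ s = -1) ∧ (t = 1 ∨ t = -1) ∧
    (Real.sqrt (m i))⁻¹ + s * (Real.sqrt (m j))⁻¹ + t * (Real.sqrt (m k))⁻¹ = 0

/-- Relations (39) p. 577 and (40) p. 578 of [AlbouyKaloshin2012]: `m₅² (m₃ + m₄)⁴ = m₃³ m₄³` and
`m₅² (m₁ + m₂)⁴ = m₁³ m₂³`, one shape `m_k² (m_i + m_j)⁴ = m_i³ m_j³`.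
[cite: AlbouyKaloshin2012, (39) p. 577, (40) p. 578] -/
def Rel39 (m : Fin 5 → ℝ) (i j k : Fin 5) : Prop :=
  m k ^ 2 * (m i + m j) ^ 4 = m i ^ 3 * m j ^ 3

/-- The mass vector `m` satisfies NONE of the printed §8 relations of [AlbouyKaloshin2012] under any
renumbering of the bodies (all pairwise distinct index tuples). This is exactly the check the Example
on p. 583 performs for "the other seven diagrams" (l. 16–19); it says nothing about the unprinted
polynomials of 8.2 (diagram 2) and 8.9.2. [cite: AlbouyKaloshin2012, p. 583] -/
def AvoidsPrintedRelations (m : Fin 5 → ℝ) : Prop :=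
  (∀ i j k : Fin 5, i ≠ j → i ≠ k → j ≠ k →
      ¬ Rel23 m i j k ∧ ¬ Rel36 m i j k ∧ ¬ Rel39 m i j k) ∧
  (∀ i j k l : Fin 5, i ≠ j → i ≠ k → i ≠ l → j ≠ k → j ≠ l → k ≠ l →
      ¬ Rel29 m i j k l ∧ ¬ Rel32 m i j k l)

/-- A signed sum of three reals vanishing forces the squared-out polynomial relation
`(x² − y² − z²)² = 4 y² z²`. [folklore] -/
theorem sqrtRel_poly {x y z s t : ℝ} (hs : s = 1 ∨ s = -1) (ht : t = 1 ∨ t = -1)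
    (h : x + s * y + t * z = 0) : (x ^ 2 - y ^ 2 - z ^ 2) ^ 2 = 4 * y ^ 2 * z ^ 2 := by
  have hx : x = -(s * y + t * z) := by linarith
  subst hx
  rcases hs with rfl | rfl <;> rcases ht with rfl | rfl <;> ring

/-- `((√a)⁻¹)² = a⁻¹` for `a ≥ 0`. [folklore] -/
theorem inv_sqrt_sq {a : ℝ} (ha : 0 ≤ a) : ((Real.sqrt a)⁻¹) ^ 2 = a⁻¹ := by
  rw [inv_pow, Real.sq_sqrt ha]

/-- Relation (36) (any signs) with nonnegative masses implies the polynomial relation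
`(m_i⁻¹ − m_j⁻¹ − m_k⁻¹)² = 4 m_j⁻¹ m_k⁻¹` (rational arithmetic once the masses are rational).
[cite: AlbouyKaloshin2012, (36) p. 577] -/
theorem rel36_poly {m : Fin 5 → ℝ} (hm : ∀ i, 0 ≤ m i) {i j k : Fin 5} (h : Rel36 m i j k) :
    ((m i)⁻¹ - (m j)⁻¹ - (m k)⁻¹) ^ 2 = 4 * (m j)⁻¹ * (m k)⁻¹ := by
  obtain ⟨s, t, hs, ht, h⟩ := h
  have := sqrtRel_poly hs ht h
  rwa [inv_sqrt_sq (hm i), inv_sqrt_sq (hm j), inv_sqrt_sq (hm k)] at this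

/-- Relation (23) is the sign pattern `(−, −)` of relation (36). [cite: AlbouyKaloshin2012, (23), (36)] -/
theorem rel23_imp_rel36 {m : Fin 5 → ℝ} {i j k : Fin 5} (h : Rel23 m i j k) : Rel36 m i j k :=
  ⟨-1, -1, Or.inr rfl, Or.inr rfl, by unfold Rel23 at h; linarith⟩

/-- Clearing denominators in the squared-out relation: for positive `x, y, z`,
`(x⁻¹ − y⁻¹ − z⁻¹)² = 4 y⁻¹ z⁻¹` implies `(y z − x z − x y)² = 4 x² y z`. [folklore] -/
theorem poly_clear {x y z : ℝ} (hx : 0 < x) (hy : 0 < y) (hz : 0 < z)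
    (h : (x⁻¹ - y⁻¹ - z⁻¹) ^ 2 = 4 * y⁻¹ * z⁻¹) :
    (y * z - x * z - x * y) ^ 2 = 4 * x ^ 2 * y * z := by
  have hx' := hx.ne'
  have hy' := hy.ne'
  have hz' := hz.ne'
  field_simp at h
  linear_combination h

/-- The masses of the Example as natural numbers. [cite: AlbouyKaloshin2012, Example p. 583] -/
def exampleMassesNat : Fin 5 → ℕ := ![1, 2, 3, 4, 5]

/-- The Example's masses are the casts of `exampleMassesNat`. [folklore] -/
theorem exampleMasses_cast (i : Fin 5) : exampleMasses12345 i = ((exampleMassesNat i : ℤ) : ℝ) := by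
  fin_cases i <;> simp [exampleMasses12345, exampleMassesNat]

/-- The Example's masses are positive. [folklore] -/
theorem exampleMassesNat_pos (i : Fin 5) : 0 < exampleMassesNat i := by
  fin_cases i <;> simp [exampleMassesNat]

/-- Integer check for (23)/(36) (cleared form) on `(1,2,3,4,5)`, all distinct triples: kernel `decide`. [folklore] -/
theorem check_sqrtRel : ∀ i j k : Fin 5, i ≠ j → i ≠ k → j ≠ k →
    ((exampleMassesNat j : ℤ) * exampleMassesNat k - exampleMassesNat i * exampleMassesNat k
        - exampleMassesNat i * exampleMassesNat j) ^ 2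
      ≠ 4 * (exampleMassesNat i : ℤ) ^ 2 * exampleMassesNat j * exampleMassesNat k := by
  decide

/-- Integer check for (39)/(40) on `(1,2,3,4,5)`, all distinct triples: kernel `decide`. [folklore] -/
theorem check_rel39 : ∀ i j k : Fin 5, i ≠ j → i ≠ k → j ≠ k →
    (exampleMassesNat k : ℤ) ^ 2 * (exampleMassesNat i + exampleMassesNat j) ^ 4
      ≠ (exampleMassesNat i : ℤ) ^ 3 * exampleMassesNat j ^ 3 := by
  decide

/-- Integer check for (29) on `(1,2,3,4,5)`, all distinct quadruples: kernel `decide`. [folklore] -/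
theorem check_rel29 : ∀ i j k l : Fin 5, i ≠ j → i ≠ k → i ≠ l → j ≠ k → j ≠ l → k ≠ l →
    (exampleMassesNat i : ℤ) * exampleMassesNat k ≠ (exampleMassesNat j : ℤ) * exampleMassesNat l := by
  decide

/-- Integer check for (32) on `(1,2,3,4,5)`: no two masses are equal (kernel `decide`). [folklore] -/
theorem check_rel32 : ∀ i j : Fin 5, i ≠ j → exampleMassesNat i ≠ exampleMassesNat j := by
  decide

/-- **Kernel-checked half of the Example, [AlbouyKaloshin2012] p. 583**: the masses `(1, 2, 3, 4, 5)`
satisfy none of the printed relations (23), (29), (32), (36), (39)/(40) under any renumbering.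
The paper's proof of the Example additionally evaluates the unprinted polynomials of 8.2 (diagram 2)
on the permuted masses (p. 583 l. 11–15); that part is not reproduced here, so this theorem does NOT
prove `albouyKaloshin2012_example12345`. [cite: AlbouyKaloshin2012, Example p. 583] -/
theorem avoidsPrintedRelations_example12345 : AvoidsPrintedRelations exampleMasses12345 := by
  have hpos : ∀ i, 0 ≤ exampleMasses12345 i := fun i => by
    rw [exampleMasses_cast]; exact_mod_cast (exampleMassesNat_pos i).le
  have hposR : ∀ i, (0 : ℝ) < ((exampleMassesNat i : ℤ) : ℝ) := fun i => by
    exact_mod_cast exampleMassesNat_pos i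
  have key : ∀ i j k : Fin 5, i ≠ j → i ≠ k → j ≠ k → ¬ Rel36 exampleMasses12345 i j k := by
    intro i j k hij hik hjk h
    have h1 := rel36_poly hpos h
    rw [exampleMasses_cast i, exampleMasses_cast j, exampleMasses_cast k] at h1
    have h2 := poly_clear (hposR i) (hposR j) (hposR k) h1
    have h3 : ((exampleMassesNat j : ℤ) * exampleMassesNat k - exampleMassesNat i * exampleMassesNat k
        - exampleMassesNat i * exampleMassesNat j) ^ 2
        = 4 * (exampleMassesNat i : ℤ) ^ 2 * exampleMassesNat j * exampleMassesNat k := by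
      exact_mod_cast h2
    exact check_sqrtRel i j k hij hik hjk h3
  refine ⟨fun i j k hij hik hjk => ⟨?_, key i j k hij hik hjk, ?_⟩,
    fun i j k l hij hik hil hjk hjl hkl => ⟨?_, ?_⟩⟩
  · exact fun h => key i j k hij hik hjk (rel23_imp_rel36 h)
  · intro h
    unfold Rel39 at h
    rw [exampleMasses_cast i, exampleMasses_cast j, exampleMasses_cast k] at h
    exact check_rel39 i j k hij hik hjk (by exact_mod_cast h)
  · intro h
    unfold Rel29 at h
    rw [exampleMasses_cast i, exampleMasses_cast j, exampleMasses_cast k, exampleMasses_cast l] at h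
    exact check_rel29 i j k l hij hik hil hjk hjl hkl (by exact_mod_cast h)
  · intro h
    obtain ⟨h1, -⟩ := h
    rw [exampleMasses_cast i, exampleMasses_cast j] at h1
    exact check_rel32 i j hij (by exact_mod_cast h1)

/-- The observation REFEREE.md R8 of the cell, kernel-checked: on the family `(a, a, a/4)` (the shape of
every Moczurad–Zgliczyński 2026 Table 3 point with `m₁ = m₂`) BOTH printed relations (23)
(`m₃^{-1/2} = m₁^{-1/2} + m₂^{-1/2}`) and (39)/(40) (`m₃²(m₁+m₂)⁴ = m₁³m₂³`) hold: two distinct printed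
codimension-1 relations among the same three masses. [cite: AlbouyKaloshin2012, (23) p. 572, (39) p. 577] -/
theorem rel23_and_rel39_equalPairQuarter {a : ℝ} (ha : 0 < a) :
    Rel23 ![a, a, a / 4, 1, 1] 2 0 1 ∧ Rel39 ![a, a, a / 4, 1, 1] 0 1 2 := by
  refine ⟨?_, ?_⟩
  · unfold Rel23
    simp only [Matrix.cons_val_zero, Matrix.cons_val_one, Matrix.head_cons, Matrix.cons_val_two,
      Matrix.tail_cons]
    have h4 : Real.sqrt (a / 4) = Real.sqrt a / 2 := by
      rw [Real.sqrt_div' _ (by norm_num : (0:ℝ) ≤ 4), show Real.sqrt 4 = 2 by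
        rw [show (4:ℝ) = 2 ^ 2 by norm_num, Real.sqrt_sq (by norm_num)]]
    rw [h4]
    have hs : 0 < Real.sqrt a := Real.sqrt_pos.mpr ha
    field_simp
    norm_num
  · unfold Rel39
    simp only [Matrix.cons_val_zero, Matrix.cons_val_one, Matrix.head_cons, Matrix.cons_val_two,
      Matrix.tail_cons]
    ring

end Literature.Dynamics.NBody
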